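import Literature.MathematicalPhysics.PowerSystems.LyapunovFunctionFamilyRegionOfAttraction
import Literature.MathematicalPhysics.PowerSystems.LyapunovFunctionFamilyClosedForm
import HarnessLib

/-!
# Vu–Turitsyn's classical 2-bus system (§V-A): an explicit exact member of the Lyapunov functions
# family and its kernel-checked stability certificate

Topic `Literature/MathematicalPhysics/PowerSystems`, namespace
`Literature.MathematicalPhysics.PowerSystems.LyapunovFunctionFamily.TwoBus`. Everything is PROVED;
the definitions are the printed system and one explicit rational certificate `(Q, K, H, ε)` of the
printed family for it (the paper computes its family members numerically; this one is chosen by hand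
so that the LMI holds exactly). The file is the worked example of
`LyapunovFunctionFamilyRegionOfAttraction.lean`: it shows that the `Certificate` structure is
inhabited for a printed system and that its two positive-semidefiniteness fields are discharged by
elementary exact arithmetic, and it states the resulting certified region of attraction.

SOURCE (read on the page). T. L. Vu, K. Turitsyn, IEEE TPWRS 31 (2016) [VuTuritsyn2016]
(arXiv:1409.1889 chunk p0011), §V-A «Classical 2 bus system»: «This system is described by a single
2-nd order differential equation m δ̈ + d δ̇ + a sin δ − P = 0. For this system δ* = arcsin(P/a) is
the only stable equilibrium point (SEP). For numerical simulations, we choose m = 1 p.u., d = 1 p.u.,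
a = 0.8 p.u., P = 0.4 p.u., and δ* = π/6.»; §III eq. (QKH) and (Lyapunov) for the family.

WHAT IS PROVED:
* `sys` — the printed system in the bilinear form (3): `System.swing` with `n = 1` machine, one line
  to the infinite bus (`E = [1]`), `m = d = 1`, line weight `a = 4/5`, `δ* = π/6` (so `P = a sin δ*
  = 2/5`); `field_inl`/`field_inr`: the field IS `ẋ₁ = x₂`, `ẋ₂ = −x₂ − (4/5)(sin(π/6 + x₁) −
  sin(π/6))`, i.e. `δ̈ + δ̇ + 0.8 sin δ − 0.4 = 0` in the deviation `x₁ = δ − π/6`.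
* `cert` — the member `Q = [[1, 1], [1, 2]]`, `K = 8/5`, `H = 4/5`, `ε = 1/4` of the family: for it
  `AᵀQ + QA = [[0, 0], [0, −2]]`, `R = QB − CᵀH − (KCA)ᵀ = 0`, so `−L = diag(0, 2, 8/5) ⪰ 0`, and
  `Q − ¼·1 = [[3/4, 1], [1, 7/4]] ⪰ 0` — both proved as quadratic-form inequalities.
* `twoBus_well_subset_regionOfAttraction` — **the certificate**: with
  `V(x) = ½(x₁² + 2x₁x₂ + 2x₂²) − (8/5)(cos(π/6 + x₁) + (π/6 + x₁)/2)` and the level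
  `c⋆ = V(0) + π²/9 + (8/5)(√3 − π/3)` (third construction with `s = 2 = CQ⁻¹Cᵀ`), for every
  `c < c⋆` every state with `|x₁ + π/3| < π` and `V(x) ≤ c` has a global solution and EVERY global
  solution from it keeps `|x₁ + π/3| < π`, `V ≤ c` and tends to `0`, i.e. `δ → π/6`, `δ̇ → 0`.

* `TwoMachine.sys` / `TwoMachine.cert` / `twoMachine_well_subset_regionOfAttraction` — the same
  machine against a second machine of equal inertia (no infinite bus), in relative coordinates
  under uniform damping (`System.relativeSwing`), certified by the CLOSED-FORM member
  `Certificate.relativeClosedForm` (`N⁻¹ = 1/2 = ν`, `c = 1`, `c' = 4`, `g = 1/2`): every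
  hypothesis is a numeral inequality — the usability check of the relative constructor.

THREE COLUMNS. CERTIFIED: the well `{|δ + δ*| < π, V ≤ c}`, `c < c⋆ ≈ 0.388` (`V(0) ≈ −1.804`), lies
in the region of attraction of `(δ*, 0)` for the MODEL `δ̈ + δ̇ + 0.8 sin δ = 0.4` (classical
single machine against an infinite bus, lossless) — kernel object, no numerics. VALIDATED (not used):
the paper's numerically optimised family member has `V_min = 0.7748` in its own normalisation
(Fig. 2); no comparison is asserted. Nothing here says a device is stable.
-/

noncomputable section

open Real Set Filter Matrix Finset
open scoped Topology

namespace Literature.MathematicalPhysics.PowerSystems.LyapunovFunctionFamily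

open ClassicalModel.LosslessSystem (vtGap)

/-! ### Two private algebra helpers: PSD from symmetry and a non-negative quadratic form -/

/-- A real matrix with `Mᵀ = M` and `xᵀMx ≥ 0` for all `x` is positive semidefinite (private
plumbing). [folklore] -/
private theorem posSemidef_of_transpose_of_nonneg {n : Type*} [Fintype n] {M : Matrix n n ℝ}
    (hsymm : Mᵀ = M) (h : ∀ x : n → ℝ, 0 ≤ x ⬝ᵥ (M *ᵥ x)) : M.PosSemidef := by
  refine Matrix.PosSemidef.of_dotProduct_mulVec_nonneg ?_ fun x => ?_
  · rw [Matrix.IsHermitian, Matrix.conjTranspose_eq_transpose_of_trivial]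
    exact hsymm
  · rw [star_trivial]
    exact h x

/-- `a u² + 2 b u v + d v² ≥ 0` when `a > 0` and `a d ≥ b²` (private plumbing). [folklore] -/
private theorem quadForm₂_nonneg {a b d : ℝ} (ha : 0 < a) (had : b ^ 2 ≤ a * d) (u v : ℝ) :
    0 ≤ a * u ^ 2 + 2 * b * u * v + d * v ^ 2 := by
  have key : a * (a * u ^ 2 + 2 * b * u * v + d * v ^ 2)
      = (a * u + b * v) ^ 2 + (a * d - b ^ 2) * v ^ 2 := by ring
  nlinarith [sq_nonneg (a * u + b * v), sq_nonneg v, key]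

namespace TwoBus

/-! ### The printed system -/

/-- Vu–Turitsyn's classical 2-bus system `m δ̈ + d δ̇ + a sin δ − P = 0` with `m = d = 1`,
`a = 0.8`, `P = 0.4`, `δ* = π/6`, in the bilinear form (3): one machine, one line (to the bus) with
`E = [1]`, weight `a = 4/5`, equilibrium line angle `π/6`.
[cite: VuTuritsyn2016, §V-A eq. for the 2-bus system and the chosen parameters] -/
def sys : System (Fin 1 ⊕ Fin 1) (Fin 1) :=
  System.swing ![1] ![1] !![1] ![4 / 5] ![π / 6]

/-- The angle equation of (3) for the 2-bus system: `ẋ₁ = x₂`. [cite: VuTuritsyn2016, §V-A and §II eq. (3)] -/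
theorem field_inl (x : Fin 1 ⊕ Fin 1 → ℝ) : sys.field x (Sum.inl 0) = x (Sum.inr 0) := by
  simp [sys, System.swing, System.field, System.nonlin, Matrix.mulVec, dotProduct,
    Fintype.sum_sum_type, Matrix.fromBlocks, Matrix.fromRows]

/-- The speed equation of (3) for the 2-bus system: `ẋ₂ = −x₂ − (4/5)(sin(π/6 + x₁) − sin(π/6))`,
i.e. `δ̈ + δ̇ + 0.8 sin δ − 0.4 = 0` with `δ = π/6 + x₁` (`0.8 sin(π/6) = 0.4`).
[cite: VuTuritsyn2016, §V-A eq. for the 2-bus system] -/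
theorem field_inr (x : Fin 1 ⊕ Fin 1 → ℝ) :
    sys.field x (Sum.inr 0)
      = -x (Sum.inr 0) - 4 / 5 * (Real.sin (π / 6 + x (Sum.inl 0)) - Real.sin (π / 6)) := by
  simp [sys, System.swing, System.field, System.nonlin, Matrix.mulVec, dotProduct,
    Fintype.sum_sum_type, Matrix.fromBlocks, Matrix.fromRows, Matrix.fromCols, Matrix.mul_apply,
    Matrix.diagonal]

/-- `Cx = x₁` for the 2-bus system. [cite: VuTuritsyn2016, §II (display for C)] -/
theorem C_mulVec (x : Fin 1 ⊕ Fin 1 → ℝ) (k : Fin 1) : (sys.C *ᵥ x) k = x (Sum.inl 0) := by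
  fin_cases k
  simp [sys, System.swing, Matrix.mulVec, dotProduct, Fintype.sum_sum_type, Matrix.fromCols]

/-- `CB = 0`. [cite: VuTuritsyn2016, Appendix 9.1 («Noting that CB = 0»)] -/
theorem C_mul_B : sys.C * sys.B = 0 := System.swing_C_mul_B _ _ _ _ _

/-- The observability condition holds (`E = [1]` is injective). [cite: VuTuritsyn2016, Appendix 9.2] -/
theorem obs (x : Fin 1 ⊕ Fin 1 → ℝ) (h1 : sys.C *ᵥ x = 0) (h2 : sys.C *ᵥ (sys.A *ᵥ x) = 0) :
    x = 0 := by
  refine System.swing_obs _ _ _ _ _ (fun v hv => ?_) x h1 h2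
  funext i
  fin_cases i
  have := congrFun hv 0
  simpa [Matrix.mulVec, dotProduct] using this

/-- `|δ*| < π/2` for `δ* = π/6`. [cite: VuTuritsyn2016, §V-A («δ* = π/6»)] -/
theorem abs_δs_lt (k : Fin 1) : |sys.δs k| < π / 2 := by
  fin_cases k
  show |π / 6| < π / 2
  rw [abs_of_pos (by positivity)]
  linarith [Real.pi_pos]

/-! ### An explicit exact member of the family -/

/-- The hand-chosen member of the family (QKH) for `sys`: `Q = [[1, 1], [1, 2]]` (on `Fin 1 ⊕ Fin 1`),
`K = 8/5`, `H = 4/5`, `ε = 1/4`. With `A = [[0, 1], [0, −1]]`, `B = [0; 4/5]`, `C = [1 0]` one has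
`AᵀQ + QA = [[0, 0], [0, −2]]`, `R = QB − CᵀH − (KCA)ᵀ = 0`, so the LMI matrix is
`L = diag(0, −2, −8/5) ≤ 0`, and `Q − ¼·1 = [[3/4, 1], [1, 7/4]] ⪰ 0`.
[cite: VuTuritsyn2016, §III eq. (QKH) (an explicit member for the §V-A system)] -/
def cert : Certificate sys where
  Q := Matrix.fromBlocks !![1] !![1] !![1] !![2]
  kK := ![8 / 5]
  h := ![4 / 5]
  ε := 1 / 4
  Q_symm := by
    rw [Matrix.fromBlocks_transpose]
    congr 1 <;> ext i j <;> fin_cases i <;> fin_cases j <;> rfl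
  ε_pos := by norm_num
  Q_ge := by
    refine posSemidef_of_transpose_of_nonneg ?_ fun x => ?_
    · rw [Matrix.transpose_sub, Matrix.transpose_smul, Matrix.transpose_one,
        Matrix.fromBlocks_transpose]
      congr 2 <;> ext i j <;> fin_cases i <;> fin_cases j <;> rfl
    · have h := quadForm₂_nonneg (a := 3 / 4) (b := 1) (d := 7 / 4) (by norm_num) (by norm_num)
        (x (Sum.inl 0)) (x (Sum.inr 0))
      have e : x ⬝ᵥ ((Matrix.fromBlocks !![(1 : ℝ)] !![1] !![1] !![2]
          - (1 / 4 : ℝ) • (1 : Matrix (Fin 1 ⊕ Fin 1) (Fin 1 ⊕ Fin 1) ℝ)) *ᵥ x)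
          = 3 / 4 * x (Sum.inl 0) ^ 2 + 2 * 1 * x (Sum.inl 0) * x (Sum.inr 0)
            + 7 / 4 * x (Sum.inr 0) ^ 2 := by
        simp [Matrix.mulVec, dotProduct, Fintype.sum_sum_type, Matrix.fromBlocks,
          Matrix.sub_apply, Matrix.one_apply]
        ring
      rw [e]
      exact h
  kK_nonneg := by
    intro k
    fin_cases k
    norm_num
  h_pos := by
    intro k
    fin_cases k
    norm_num
  lmi := by
    have hP : sys.Aᵀ * Matrix.fromBlocks !![(1 : ℝ)] !![1] !![1] !![2]
        + Matrix.fromBlocks !![(1 : ℝ)] !![1] !![1] !![2] * sys.A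
        = Matrix.fromBlocks 0 0 0 !![-2] := by
      ext (i | i) (j | j) <;> fin_cases i <;> fin_cases j <;>
        norm_num [sys, System.swing, Matrix.mul_apply, Fintype.sum_sum_type, Matrix.fromBlocks,
          Matrix.transpose_apply, Matrix.diagonal]
    have hR : Matrix.fromBlocks !![(1 : ℝ)] !![1] !![1] !![2] * sys.B
        - sys.Cᵀ * diagonal ![(4 : ℝ) / 5] - (diagonal ![(8 : ℝ) / 5] * sys.C * sys.A)ᵀ = 0 := by
      ext (i | i) j <;> fin_cases i <;> fin_cases j <;>
        norm_num [sys, System.swing, Matrix.mul_apply, Fintype.sum_sum_type, Matrix.fromBlocks,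
          Matrix.fromRows, Matrix.fromCols, Matrix.transpose_apply, Matrix.diagonal]
    rw [hP, hR]
    refine posSemidef_of_transpose_of_nonneg ?_ fun z => ?_
    · have h1 : (!![(-2 : ℝ)])ᵀ = !![(-2 : ℝ)] := by
        ext i j
        fin_cases i
        fin_cases j
        rfl
      rw [Matrix.transpose_neg, Matrix.fromBlocks_transpose, Matrix.fromBlocks_transpose,
        Matrix.transpose_transpose, h1, Matrix.transpose_smul, Matrix.diagonal_transpose]
      simp only [Matrix.transpose_zero]
    · have e : z ⬝ᵥ ((-Matrix.fromBlocks (Matrix.fromBlocks (0 : Matrix (Fin 1) (Fin 1) ℝ) 0 0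
          !![(-2 : ℝ)]) (0 : Matrix (Fin 1 ⊕ Fin 1) (Fin 1) ℝ) (0 : Matrix (Fin 1 ⊕ Fin 1) (Fin 1) ℝ)ᵀ
          (-(2 : ℝ) • diagonal ![(4 : ℝ) / 5])) *ᵥ z)
          = 2 * z (Sum.inl (Sum.inr 0)) ^ 2 + 8 / 5 * z (Sum.inr 0) ^ 2 := by
        simp [Matrix.mulVec, dotProduct, Fintype.sum_sum_type, Matrix.fromBlocks,
          Matrix.neg_apply, Matrix.diagonal]
        ring
      rw [e]
      positivity

/-- The certificate's Lyapunov function, written out: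
`V(x) = ½(x₁² + 2x₁x₂ + 2x₂²) − (8/5)(cos(π/6 + x₁) + (π/6 + x₁) sin(π/6))`.
[cite: VuTuritsyn2016, §III eq. (Lyapunov)] -/
theorem V_eq (x : Fin 1 ⊕ Fin 1 → ℝ) :
    cert.V x = 1 / 2 * (x (Sum.inl 0) ^ 2 + 2 * x (Sum.inl 0) * x (Sum.inr 0)
      + 2 * x (Sum.inr 0) ^ 2)
      - 8 / 5 * (Real.cos (π / 6 + x (Sum.inl 0)) + (π / 6 + x (Sum.inl 0)) * Real.sin (π / 6)) := by
  simp [Certificate.V, cert, sys, System.swing, Matrix.mulVec, dotProduct, Fintype.sum_sum_type,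
    Matrix.fromBlocks, Matrix.fromCols]
  ring

/-- `V(0) = −(8/5)(√3/2 + π/12)`. [cite: VuTuritsyn2016, §III eq. (Lyapunov)] -/
theorem V_zero_eq : cert.V 0 = -(8 / 5) * (Real.sqrt 3 / 2 + π / 12) := by
  rw [V_eq]
  simp only [Pi.zero_apply, add_zero]
  rw [Real.cos_pi_div_six, Real.sin_pi_div_six]
  ring

/-- The polytope is `{|x₁ + π/3| < π}`, i.e. `|δ + δ*| < π` with `δ = π/6 + x₁`.
[cite: VuTuritsyn2016, §IV (definition of 𝒫)] -/
theorem mem_polytope_iff (x : Fin 1 ⊕ Fin 1 → ℝ) :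
    x ∈ sys.polytope ↔ |x (Sum.inl 0) + π / 3| < π := by
  constructor
  · intro h
    have h0 := h 0
    rw [C_mulVec] at h0
    have e : (sys.δs 0 + x (Sum.inl 0)) + sys.δs 0 = x (Sum.inl 0) + π / 3 := by
      show (π / 6 + x (Sum.inl 0)) + π / 6 = x (Sum.inl 0) + π / 3
      ring
    rwa [e] at h0
  · intro h k
    fin_cases k
    rw [C_mulVec]
    have e : (sys.δs 0 + x (Sum.inl 0)) + sys.δs 0 = x (Sum.inl 0) + π / 3 := by
      show (π / 6 + x (Sum.inl 0)) + π / 6 = x (Sum.inl 0) + π / 3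
      ring
    show |(sys.δs 0 + x (Sum.inl 0)) + sys.δs 0| < π
    rwa [e]

/-- The rank-one certificate of the third construction: `2·Q − CᵀC = [[1, 2], [2, 4]] ⪰ 0`
(`s = 2 = CQ⁻¹Cᵀ`). [cite: VuTuritsyn2016, §IV eq. (approximate)] -/
theorem rankOne_posSemidef (k : Fin 1) :
    ((2 : ℝ) • cert.Q - Matrix.vecMulVec (sys.C k) (sys.C k)).PosSemidef := by
  fin_cases k
  have hC : sys.C 0 = Sum.elim ![(1 : ℝ)] ![0] := by
    funext s
    rcases s with i | i <;> fin_cases i <;>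
      simp [sys, System.swing, Matrix.fromCols]
  refine posSemidef_of_transpose_of_nonneg ?_ fun x => ?_
  · rw [Matrix.transpose_sub, Matrix.transpose_smul, Matrix.transpose_vecMulVec]
    congr 1
    show ((2 : ℝ) • (Matrix.fromBlocks !![(1 : ℝ)] !![1] !![1] !![2]))ᵀ
      = (2 : ℝ) • Matrix.fromBlocks !![(1 : ℝ)] !![1] !![1] !![2]
    rw [Matrix.transpose_smul, Matrix.fromBlocks_transpose]
    congr 2 <;> ext i j <;> fin_cases i <;> fin_cases j <;> rfl
  · show 0 ≤ x ⬝ᵥ (((2 : ℝ) • (Matrix.fromBlocks !![(1 : ℝ)] !![1] !![1] !![2])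
      - Matrix.vecMulVec (sys.C 0) (sys.C 0)) *ᵥ x)
    rw [hC]
    have e : x ⬝ᵥ (((2 : ℝ) • (Matrix.fromBlocks !![(1 : ℝ)] !![1] !![1] !![2])
        - Matrix.vecMulVec (Sum.elim ![(1 : ℝ)] ![0]) (Sum.elim ![(1 : ℝ)] ![0])) *ᵥ x)
        = (x (Sum.inl 0) + 2 * x (Sum.inr 0)) ^ 2 := by
      simp [Matrix.mulVec, dotProduct, Fintype.sum_sum_type, Matrix.fromBlocks, Matrix.sub_apply,
        Matrix.vecMulVec_apply]
      ring
    rw [e]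
    positivity

/-- The closed-form level of the third construction for this certificate:
`c⋆ = V(0) + π²/9 + (8/5)·(√3 − π/3)` (`q = (π − 2·π/6)²/(2·2) = π²/9`,
`K·vtGap(π/6) = (8/5)(2cos(π/6) − (π − π/3) sin(π/6))`). [cite: VuTuritsyn2016, §IV eq. (approximate)] -/
theorem level_eq :
    cert.V 0 + (π - 2 * |sys.δs 0|) ^ 2 / (2 * 2) + cert.kK 0 * vtGap (sys.δs 0)
      = cert.V 0 + π ^ 2 / 9 + 8 / 5 * (Real.sqrt 3 - π / 3) := by
  have hδ : sys.δs 0 = π / 6 := rfl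
  have hK : cert.kK 0 = 8 / 5 := rfl
  rw [hδ, hK, vtGap, abs_of_pos (by positivity : (0 : ℝ) < π / 6), Real.cos_pi_div_six,
    Real.sin_pi_div_six]
  ring

/-- **The certified stability region of the 2-bus system from the explicit family member.** For
every level `c < V(0) + π²/9 + (8/5)(√3 − π/3)` and every state `y` with `|y₁ + π/3| < π` and
`V(y) ≤ c`: a global solution of `ẋ₁ = x₂, ẋ₂ = −x₂ − 0.8(sin(π/6 + x₁) − sin(π/6))` from `y`
exists, and EVERY global solution `X` from `y` keeps `|X₁(t) + π/3| < π`, `V(X t) ≤ c` for all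
`t ≥ 0` and tends to `0` — i.e. `δ(t) → δ* = π/6`, `δ̇(t) → 0`. CERTIFIED for the MODEL
`δ̈ + δ̇ + 0.8 sin δ = 0.4`, CLASS = the well; inner estimate; no numerical input.
[cite: VuTuritsyn2016, §V-A (2-bus system) with §IV (set ℛ, third construction)] -/
theorem twoBus_well_subset_regionOfAttraction {c : ℝ}
    (hc : c < cert.V 0 + π ^ 2 / 9 + 8 / 5 * (Real.sqrt 3 - π / 3))
    {y : Fin 1 ⊕ Fin 1 → ℝ} (hy : |y (Sum.inl 0) + π / 3| < π) (hyc : cert.V y ≤ c) :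
    (∃ X : ℝ → Fin 1 ⊕ Fin 1 → ℝ, X 0 = y ∧
        ∀ T : ℝ, ∀ t ∈ Icc 0 T, HasDerivWithinAt X (sys.field (X t)) (Icc 0 T) t) ∧
      ∀ X : ℝ → Fin 1 ⊕ Fin 1 → ℝ, X 0 = y →
        (∀ T : ℝ, ∀ t ∈ Icc 0 T, HasDerivWithinAt X (sys.field (X t)) (Icc 0 T) t) →
        (∀ t, 0 ≤ t → |X t (Sum.inl 0) + π / 3| < π ∧ cert.V (X t) ≤ c) ∧
          Tendsto X atTop (𝓝 0) := by
  have hc' : ∀ k : Fin 1, c < cert.V 0 + (π - 2 * |sys.δs k|) ^ 2 / (2 * (2 : ℝ))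
      + cert.kK k * vtGap (sys.δs k) := by
    intro k
    fin_cases k
    show c < cert.V 0 + (π - 2 * |sys.δs 0|) ^ 2 / (2 * 2) + cert.kK 0 * vtGap (sys.δs 0)
    rw [level_eq]
    exact hc
  have key := cert.well_subset_regionOfAttraction_of_gapQ C_mul_B abs_δs_lt obs
    (s := fun _ => (2 : ℝ)) (fun _ => by norm_num) rankOne_posSemidef hc'
    ((mem_polytope_iff y).2 hy) hyc
  refine ⟨key.1, fun X hX0 hX => ?_⟩
  obtain ⟨hstay, htend⟩ := key.2 X hX0 hX
  exact ⟨fun t ht => ⟨(mem_polytope_iff (X t)).1 (hstay t ht).1, (hstay t ht).2⟩, htend⟩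

end TwoBus

/-! ### The same machine against a second machine of equal inertia: the relative closed form, worked

The two-machine system without an infinite bus, written in the angle of machine 1 RELATIVE to
machine 2 under uniform damping (Sauer–Pai §6.10: with one angle as reference the reference
machine's equations drop out), is `System.relativeSwing` with one relative machine and one line; for
`m = M_ref = 1`, `λ = 1`, line weight `4/5` and equilibrium line angle `π/6` (the data of the 2-bus
example) the closed-form member `Certificate.relativeClosedForm` applies with `N = 1/m + 1/M_ref = 2`,
`N⁻¹ = 1/2 = ν`, `c = 1`, `c' = 4`, `g = 1/2` — every hypothesis is a numeral inequality. This is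
the usability check of the relative constructor (no matrix certificate, no solver). -/

namespace TwoMachine

/-- The two-machine system in relative coordinates, uniform damping `λ = 1`, `m = M_ref = 1`, one
line of weight `4/5` with equilibrium angle `π/6`:
`θ̈ = −θ̇ − 2·(4/5)(sin(π/6 + θ − θ*) − sin(π/6))` (reduced inertia `m M_ref/(m + M_ref) = 1/2`).
[cite: SauerPai1998, §6.10 eqs. (6.238)–(6.241) (relative angles; reference machine drops out under uniform damping)] -/
def sys : System (Fin 1 ⊕ Fin 1) (Fin 1) :=
  System.relativeSwing ![1] 1 1 !![1] ![4 / 5] ![π / 6]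

/-- The closed-form member for the two-machine system: `N⁻¹ = [1/2]`, `ν = 1/2`, `c = 1`, `c' = 4`,
`g = 1/2` (so `Q = [[1/2, 1/2], [1/2, 2]]`, `K = 16/5`, `H = 4/5`, `ε = 1/4`); all ten hypotheses
of `Certificate.relativeClosedForm` are numeral facts. [cite: VuTuritsyn2016, §III eq. (QKH) (closed-form member, relative form)] -/
def cert : Certificate sys :=
  Certificate.relativeClosedForm ![1] 1 1 !![1] ![4 / 5] ![π / 6] !![1 / 2] 1 4 (1 / 2) (1 / 2)
    (by
      ext i j
      fin_cases i
      fin_cases j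
      simp [Matrix.mul_apply, Matrix.diagonal]
      norm_num)
    (by
      ext i j
      fin_cases i
      fin_cases j
      rfl)
    (by norm_num)
    (by
      have e : (!![(1 / 2 : ℝ)] - (1 / 2 : ℝ) • (1 : Matrix (Fin 1) (Fin 1) ℝ)) = 0 := by
        ext i j
        fin_cases i
        fin_cases j
        simp
      rw [e]
      exact Matrix.PosSemidef.zero)
    (fun k => by fin_cases k; norm_num) (by norm_num) (by norm_num) (by norm_num) (by norm_num)
    (by norm_num) (by norm_num) (by norm_num)

/-- `ker E = 0` for `E = [1]`. [cite: VuTuritsyn2016, Appendix 9.2] -/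
theorem kerE (v : Fin 1 → ℝ) (hv : !![(1 : ℝ)] *ᵥ v = 0) : v = 0 := by
  funext i
  fin_cases i
  have := congrFun hv 0
  simpa [Matrix.mulVec, dotProduct] using this

/-- **The certified synchronization region of the two-machine system from the relative closed
form.** For every `c₀ < V(0) + 4·(4/5)·vtGap(π/6)` and every state `y` in the polytope with
`V(y) ≤ c₀`: a global solution exists and EVERY global solution keeps `{𝒫, V ≤ c₀}` and tends to
`0` (the machines resynchronise at the relative angle `π/6`). No solver, no matrix certificate.
[cite: VuTuritsyn2016, §IV (set ℛ, third construction) with §III eq. (QKH); SauerPai1998, §6.10] -/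
theorem twoMachine_well_subset_regionOfAttraction {c₀ : ℝ}
    (hc₀ : c₀ < cert.V 0 + 4 * (4 / 5) * vtGap (π / 6))
    {y : Fin 1 ⊕ Fin 1 → ℝ} (hy : y ∈ sys.polytope) (hyc : cert.V y ≤ c₀) :
    (∃ X : ℝ → Fin 1 ⊕ Fin 1 → ℝ, X 0 = y ∧
        ∀ T : ℝ, ∀ t ∈ Icc 0 T, HasDerivWithinAt X (sys.field (X t)) (Icc 0 T) t) ∧
      ∀ X : ℝ → Fin 1 ⊕ Fin 1 → ℝ, X 0 = y →
        (∀ T : ℝ, ∀ t ∈ Icc 0 T, HasDerivWithinAt X (sys.field (X t)) (Icc 0 T) t) →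
        (∀ t, 0 ≤ t → X t ∈ sys.polytope ∧ cert.V (X t) ≤ c₀) ∧ Tendsto X atTop (𝓝 0) :=
  Certificate.relativeClosedForm_well_subset_regionOfAttraction ![1] 1 1 !![1] ![4 / 5] ![π / 6]
    !![1 / 2] 1 4 (1 / 2) (1 / 2) _ _ _ _ _ _ _ _ _ _ _ _ kerE
    (fun k => by
      fin_cases k
      show |π / 6| < π / 2
      rw [abs_of_pos (by positivity)]
      linarith [Real.pi_pos])
    (fun k => by
      fin_cases k
      exact hc₀)
    hy hyc

end TwoMachine

end Literature.MathematicalPhysics.PowerSystems.LyapunovFunctionFamily
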